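import Literature.NumberTheory.Automorphic.IwasawaCoordinatesAdelic
import Literature.NumberTheory.Automorphic.WhittakerSupportFinite
import Literature.NumberTheory.Automorphic.UnipotentTateDomain
import Literature.NumberTheory.Automorphic.AdelicAdditiveCharacterDuality
import Literature.NumberTheory.Automorphic.GlobalAdditiveCharacterProofs
import Literature.NumberTheory.Automorphic.AdelicRationalVectorCount
import Literature.NumberTheory.Automorphic.FiniteAdeleSchwartzBruhatFourier
import HarnessLib

/-!
# Inputs for the majorant of the Whittaker series of a cusp form on `GL_n(𝔸_K)`

Topic `NumberTheory/Automorphic`; namespace `Literature.NumberTheory.Automorphic`. Proof file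
(theorems only) collecting the elementary inputs of the absolute convergence of the
Fourier–Whittaker expansion of a cusp form (Cogdell (2004), Thm. 1.1; Jacquet–Piatetski-Shapiro–
Shalika (1979)): a counting lemma (`summable_of_le_mul_prod_of_injOn`: a nonnegative family
dominated, through an injection into `m`-tuples of lattice vectors, by products of summable weights
is summable), valuation bookkeeping at the finite places (global integers of prescribed smallness,
`exists_ne_zero_forall_valuation_le`; the support bound attached to Tate's character,
`exists_finset_bound_adeleAddCharAt`; rows of matrices in `GL_n(𝒪̂)`), and the boundedness of
Tate's additive fundamental domain (`exists_forall_norm_le_of_mem_adeleFundamentalDomain`).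

## References

* J. W. Cogdell, *Analytic theory of L-functions for GL_n* (2004), Thm. 1.1
  [CogdellAnalyticTheory2004].
* J. W. S. Cassels, A. Fröhlich (eds.), *Algebraic Number Theory* (1967), Ch. XV (Tate)
  [CasselsFrohlichANT1967].
-/

noncomputable section

open NumberField NumberField.mixedEmbedding NumberField.InfinitePlace IsDedekindDomain Matrix Set
open scoped MatrixGroups Classical NNReal ENNReal

namespace Literature.NumberTheory.Automorphic

/-! ### Counting through an injection into tuples of lattice vectors -/

section Counting

/-- `∑_{f : Fin m → S} ∏_i w(f i) = (∑_{s ∈ S} w s)^m` in `ℝ≥0∞`. [folklore] -/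
theorem ENNReal.tsum_pi_fin_prod_eq_pow {V : Type*} (S : Set V) (w : V → ℝ≥0∞) (m : ℕ) :
    ∑' f : Fin m → S, ∏ i, w (f i) = (∑' s : S, w s) ^ m := by
  induction m with
  | zero => simp [tsum_fintype]
  | succ m ih =>
    rw [pow_succ', ← ih, ← (Fin.consEquiv fun _ : Fin (m + 1) => ↥S).tsum_eq]
    have e : ∀ p : ↥S × (Fin m → ↥S), (∏ i, w ((Fin.consEquiv (fun _ : Fin (m + 1) => ↥S) p i : ↥S))) =
        w p.1 * ∏ i, w (p.2 i) := by
      intro p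
      rw [Fin.prod_univ_succ]
      simp only [Fin.consEquiv, Equiv.coe_fn_mk, Fin.cons_zero, Fin.cons_succ]
    simp_rw [e]
    rw [ENNReal.tsum_prod', ENNReal.tsum_mul_right.symm]
    refine tsum_congr fun s => ?_
    dsimp only
    exact ENNReal.tsum_mul_left

/-- **Counting through an injection into tuples of lattice vectors.** A nonnegative real family
`a : ι → ℝ` such that every `c` with `a c ≠ 0` carries an `m`-tuple `F c` of elements of `S`,
injectively in `c`, with `a c ≤ C ∏_i w(F c i)` for weights `w` summable over `S`, is summable
(`∑_c a c ≤ C (∑_{s ∈ S} w s)^m`). This is the comparison step in the proof of the absolute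
convergence of Fourier–Whittaker expansions (Cogdell (2004), Thm. 1.1). [folklore] -/
theorem summable_of_le_mul_prod_of_injOn {ι V : Type*} {m : ℕ} {a : ι → ℝ} (ha : ∀ c, 0 ≤ a c)
    {S : Set V} {w : V → ℝ≥0∞} (hw : ∑' s : S, w s ≠ ⊤) {C : ℝ≥0∞} (hC : C ≠ ⊤) (F : ι → Fin m → V)
    (hinj : Set.InjOn F {c | a c ≠ 0}) (hmem : ∀ c, a c ≠ 0 → ∀ i, F c i ∈ S)
    (hle : ∀ c, a c ≠ 0 → ENNReal.ofReal (a c) ≤ C * ∏ i, w (F c i)) : Summable a := by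
  set T : Set ι := {c | a c ≠ 0} with hT
  set g : ι → ℝ≥0∞ := fun c => C * ∏ i, w (F c i) with hg
  -- pointwise domination by the indicator of `g` on the support
  have h1 : ∀ c, ENNReal.ofReal (a c) ≤ T.indicator g c := by
    intro c
    by_cases hc : a c = 0
    · rw [hc, ENNReal.ofReal_zero]; exact zero_le
    · rw [Set.indicator_of_mem (show c ∈ T from hc)]; exact hle c hc
  -- the injection into tuples
  set Φ : ↥T → (Fin m → ↥S) := fun c i => ⟨F c i, hmem c c.2 i⟩ with hΦ
  have hΦ_inj : Function.Injective Φ := by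
    intro c c' h
    apply Subtype.ext
    refine hinj c.2 c'.2 (funext fun i => ?_)
    have := congrFun h i
    exact congrArg Subtype.val this
  have h2 : ∑' c : ↥T, ∏ i, w (F c i) ≤ ∑' f : Fin m → ↥S, ∏ i, w (f i) := by
    have h := ENNReal.tsum_comp_le_tsum_of_injective hΦ_inj (fun f : Fin m → ↥S => ∏ i, w (f i))
    exact h
  have hbound : ∑' c, ENNReal.ofReal (a c) ≤ C * (∑' s : S, w s) ^ m := by
    calc ∑' c, ENNReal.ofReal (a c) ≤ ∑' c, T.indicator g c := ENNReal.tsum_le_tsum h1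
      _ = ∑' c : ↥T, g c := (tsum_subtype T g).symm
      _ = C * ∑' c : ↥T, ∏ i, w (F c i) := ENNReal.tsum_mul_left
      _ ≤ C * ∑' f : Fin m → ↥S, ∏ i, w (f i) := mul_le_mul' le_rfl h2
      _ = C * (∑' s : S, w s) ^ m := by rw [ENNReal.tsum_pi_fin_prod_eq_pow]
  have hfin : ∑' c, ENNReal.ofReal (a c) ≠ ⊤ :=
    ne_top_of_le_ne_top (ENNReal.mul_ne_top hC (ENNReal.pow_ne_top hw)) hbound
  -- back to real numbers
  have hnn : Summable fun c => (a c).toNNReal := by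
    rw [← ENNReal.tsum_coe_ne_top_iff_summable]
    exact hfin
  have h3 : (fun c => ((a c).toNNReal : ℝ)) = a := funext fun c => Real.coe_toNNReal _ (ha c)
  rw [← h3]
  exact NNReal.summable_coe.2 hnn

end Counting

/-! ### Global integers of prescribed smallness at finitely many places -/

section Valuation

variable (K : Type) [Field K] [NumberField K]

/-- For a finite place `v` and a nonzero bound `β ∈ ℤₘ₀` there is a nonzero global integer `c` with
`|c|_v ≤ β` (a power of a uniformizer of `𝔭_v` lying in `𝓞_K`). [folklore] -/
theorem exists_ne_zero_valuation_le (v : HeightOneSpectrum (𝓞 K)) {β : WithZero (Multiplicative ℤ)} (hβ : β ≠ 0) :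
    ∃ c : 𝓞 K, c ≠ 0 ∧ v.valuation K (c : K) ≤ β := by
  obtain ⟨π, hπ⟩ := v.intValuation_exists_uniformizer
  have hπ0 : π ≠ 0 := by
    intro h
    rw [h, map_zero] at hπ
    exact WithZero.exp_ne_zero hπ.symm
  obtain ⟨N, hN⟩ : ∃ N : ℕ, WithZero.exp (-(N : ℤ)) ≤ β := by
    refine ⟨(-WithZero.log β).toNat, ?_⟩
    rw [← WithZero.le_log_iff_exp_le hβ]
    omega
  refine ⟨π ^ N, pow_ne_zero N hπ0, ?_⟩
  have h1 : v.valuation K ((π ^ N : 𝓞 K) : K) = WithZero.exp (-(N : ℤ)) := by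
    rw [show ((π ^ N : 𝓞 K) : K) = algebraMap (𝓞 K) K (π ^ N) from rfl, HeightOneSpectrum.valuation_of_algebraMap,
      map_pow, hπ, ← WithZero.exp_nsmul, nsmul_eq_mul, mul_neg, mul_one]
  rw [h1]
  exact hN

/-- For finitely many finite places `v ∈ S` and nonzero bounds `β_v` there is a nonzero global
integer `e` with `|e|_v ≤ β_v` for all `v ∈ S` (and `|e|_w ≤ 1` everywhere). [folklore] -/
theorem exists_ne_zero_forall_valuation_le (S : Finset (HeightOneSpectrum (𝓞 K))) {β : HeightOneSpectrum (𝓞 K) → WithZero (Multiplicative ℤ)}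
    (hβ : ∀ v, β v ≠ 0) :
    ∃ e : 𝓞 K, e ≠ 0 ∧ ∀ v ∈ S, v.valuation K (e : K) ≤ β v := by
  choose c hc0 hc using fun v => exists_ne_zero_valuation_le K v (hβ v)
  refine ⟨∏ v ∈ S, c v, Finset.prod_ne_zero_iff.2 fun v _ => hc0 v, fun v hv => ?_⟩
  rw [show ((∏ v ∈ S, c v : 𝓞 K) : K) = algebraMap (𝓞 K) K (∏ v ∈ S, c v) from rfl, map_prod, map_prod,
    ← Finset.mul_prod_erase _ _ hv]
  refine (mul_le_of_le_one_right' (Finset.prod_le_one' fun w _ => v.valuation_le_one (c w))).trans ?_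
  exact hc v

end Valuation

/-! ### The support bound attached to Tate's character -/

section TateBound

variable (K : Type) [Field K] [NumberField K]

/-- **The finite-place bound attached to Tate's character and a level `𝔫 ≠ 0`.** There are a finite
set `S` of finite places and bounds `B_v ≥ 1`, `B_v = 1` off `S`, such that at every `v`: whenever
`a · |𝔫|_v < |x|_v · b` for all `x ∈ K_v` with `ψ_v(x) ≠ 1`, then `a ≤ B_v · b`. Off `S`, `ψ_v` is
non-trivial on some `x` with `|x|_v ≤ q_v` (`eventually_exists_adeleAddCharAt_ne_one`) and
`|𝔫|_v = 1`, and the value group is discrete; on `S`, `ψ_v ≠ 1` (`adicComponent_adeleAddChar_ne_one`).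
[cite: CasselsFrohlichANT1967, Ch. XV Lemma 4.1.5] -/
theorem exists_finset_bound_adeleAddCharAt {𝔫 : Ideal (𝓞 K)} (h𝔫 : 𝔫 ≠ 0) :
    ∃ (S : Finset (HeightOneSpectrum (𝓞 K))) (B : HeightOneSpectrum (𝓞 K) → WithZero (Multiplicative ℤ)),
      (∀ v, 1 ≤ B v) ∧ (∀ v, v ∉ S → B v = 1) ∧
      ∀ (v : HeightOneSpectrum (𝓞 K)) (a b : WithZero (Multiplicative ℤ)),
        (∀ x : v.adicCompletion K, adeleAddCharAt K v x ≠ 1 → a * idealRadius K v 𝔫 < Valued.v x * b) → a ≤ B v * b := by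
  -- a non-trivial argument of `ψ_v` at every place
  have hex : ∀ v : HeightOneSpectrum (𝓞 K), ∃ x : v.adicCompletion K, adeleAddCharAt K v x ≠ 1 := by
    intro v
    have h := adicComponent_adeleAddChar_ne_one (K := K) v
    rw [← adeleAddCharAt_eq_adicComponent] at h
    exact AddChar.ne_one_iff.1 h
  choose x₀ hx₀ using hex
  -- the finite exceptional set
  have hgood := eventually_exists_adeleAddCharAt_ne_one K
  rw [Filter.eventually_cofinite] at hgood
  set S : Finset (HeightOneSpectrum (𝓞 K)) := hgood.toFinset ∪ (Ideal.finite_factors h𝔫).toFinset with hS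
  refine ⟨S, fun v => if v ∈ S then max 1 (Valued.v (x₀ v) * (idealRadius K v 𝔫)⁻¹) else 1, fun v => ?_, fun v hv => ?_,
    fun v a b hab => ?_⟩
  · dsimp only
    by_cases hv : v ∈ S
    · rw [if_pos hv]; exact le_max_left _ _
    · rw [if_neg hv]
  · dsimp only
    rw [if_neg hv]
  · dsimp only
    have hr0 : idealRadius K v 𝔫 ≠ 0 := WithZero.exp_ne_zero
    by_cases hb : b = 0
    · -- the hypothesis is contradictory
      have h := hab (x₀ v) (hx₀ v)
      rw [hb, mul_zero] at h
      exact absurd h not_lt_zero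
    by_cases hv : v ∈ S
    · rw [if_pos hv]
      have h := hab (x₀ v) (hx₀ v)
      have h' : a < Valued.v (x₀ v) * (idealRadius K v 𝔫)⁻¹ * b := by
        calc a = a * idealRadius K v 𝔫 * (idealRadius K v 𝔫)⁻¹ := by rw [mul_assoc, mul_inv_cancel₀ hr0, mul_one]
          _ < Valued.v (x₀ v) * b * (idealRadius K v 𝔫)⁻¹ := mul_lt_mul_of_pos_right h (zero_lt_iff.2 (inv_ne_zero hr0))
          _ = Valued.v (x₀ v) * (idealRadius K v 𝔫)⁻¹ * b := mul_right_comm _ _ _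
      exact h'.le.trans (mul_le_mul' (le_max_right _ _) le_rfl)
    · rw [if_neg hv, one_mul]
      have hv' : v ∉ hgood.toFinset ∧ v ∉ (Ideal.finite_factors h𝔫).toFinset := by
        simpa [hS, Finset.mem_union] using hv
      have hgv : ∃ u : v.adicCompletion K, Valued.v u ≤ WithZero.exp (1 : ℤ) ∧ adeleAddCharAt K v u ≠ 1 := by
        have := hv'.1
        rw [Set.Finite.mem_toFinset] at this
        simpa using this
      have hdv : ¬ v.asIdeal ∣ 𝔫 := by
        have := hv'.2
        rwa [Set.Finite.mem_toFinset] at this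
      obtain ⟨u, hu, hψu⟩ := hgv
      have h := hab u hψu
      rw [idealRadius_eq_one_of_not_dvd h𝔫 hdv, mul_one] at h
      have h' : a < b * WithZero.exp 1 :=
        h.trans_le ((mul_le_mul' hu le_rfl).trans_eq (mul_comm _ _))
      exact (WithZero.lt_mul_exp_iff_le hb).1 h'

end TateBound

/-! ### Tate's additive fundamental domain is bounded -/

section Box

variable (K : Type) [Field K] [NumberField K]

/-- **The box bounds of Tate's fundamental domain.** There is `B ≥ 1` such that every
`a ∈ D ∪ {0, 1}` has archimedean component of norm `≤ B` (in `K ⊗ ℝ`) and integral finite components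
(`D = D_∞ × ∏_v 𝒪_v` with `D_∞` a bounded parallelotope, Mathlib `ZSpan.fundamentalDomain_isBounded`).
[cite: CasselsFrohlichANT1967, Ch. XV Def. 4.1.2] -/
theorem exists_forall_norm_le_of_mem_adeleFundamentalDomain :
    ∃ B : ℝ, 1 ≤ B ∧ ∀ a : AdeleRing (𝓞 K) K, (a ∈ adeleFundamentalDomain K ∨ a = 0 ∨ a = 1) →
      ‖InfiniteAdeleRing.ringEquiv_mixedSpace K a.1‖ ≤ B ∧ ∀ v, a.2 v ∈ v.adicCompletionIntegers K := by
  obtain ⟨B₀, hB₀⟩ := (ZSpan.fundamentalDomain_isBounded (latticeBasis K)).exists_norm_le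
  refine ⟨max B₀ 1, le_max_right _ _, fun a ha => ?_⟩
  rcases ha with ha | rfl | rfl
  · exact ⟨(hB₀ _ ((mem_adeleFundamentalDomain K).1 ha).2).trans (le_max_left _ _), fun v => ha.1 v⟩
  · refine ⟨?_, fun v => ?_⟩
    · rw [show (0 : AdeleRing (𝓞 K) K).1 = 0 from rfl, map_zero, norm_zero]; positivity
    · exact zero_mem _
  · refine ⟨?_, fun v => ?_⟩
    · rw [show (1 : AdeleRing (𝓞 K) K).1 = 1 from rfl, map_one]
      have h1 : ‖(1 : mixedSpace K)‖ ≤ 1 := by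
        rw [Prod.norm_def]
        refine max_le ?_ ?_ <;> exact (pi_norm_le_iff_of_nonneg zero_le_one).2 fun _ => by simp
      exact h1.trans (le_max_right _ _)
    · exact one_mem _

end Box

/-! ### Rows of Iwasawa coordinates -/

section Rows

variable {n : ℕ} {K : Type} [Field K] [NumberField K]

/-- `|x_w| ≤ ‖x‖` for `x ∈ K ⊗ ℝ` (sup norm). [folklore] -/
theorem norm_mixedSpaceEvalAt_le (w : InfinitePlace K) (x : mixedSpace K) : ‖mixedSpaceEvalAt K w x‖ ≤ ‖x‖ := by
  by_cases hw : w.IsReal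
  · rw [mixedSpaceEvalAt_of_isReal hw, Complex.norm_real]
    exact (norm_le_pi_norm _ _).trans (norm_fst_le _)
  · rw [mixedSpaceEvalAt_of_isComplex (not_isReal_iff_isComplex.1 hw)]
    exact (norm_le_pi_norm _ _).trans (norm_snd_le _)

/-- Entries of the finite component: `(h_f)_{ij} = (h_{ij})_f` (definitional). [folklore] -/
theorem GLn.coe_sndHom_apply' (g : GL (Fin n) (AdeleRing (𝓞 K) K)) (i j : Fin n) :
    ((GLn.sndHom n K g : GL (Fin n) (FiniteAdeleRing (𝓞 K) K)) : Matrix (Fin n) (Fin n) (FiniteAdeleRing (𝓞 K) K)) i j =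
      ((g : Matrix (Fin n) (Fin n) (AdeleRing (𝓞 K) K)) i j).2 := rfl

/-- Entries of the archimedean component: `(h_∞)_{ij} = e((h_{ij})_∞)` (definitional). [folklore] -/
theorem GLn.coe_toMixed_apply' (g : GL (Fin n) (AdeleRing (𝓞 K) K)) (i j : Fin n) :
    ((GLn.toMixed n K g : GL (Fin n) (mixedSpace K)) : Matrix (Fin n) (Fin n) (mixedSpace K)) i j =
      InfiniteAdeleRing.ringEquiv_mixedSpace K (((g : Matrix (Fin n) (Fin n) (AdeleRing (𝓞 K) K)) i j).1) := rfl

/-- **Every row of a matrix in `GL_n(𝒪̂_K)` contains a unit at each place**: for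
`k ∈ GL_n(𝒪̂_K)`, a finite place `v` and a row `i`, some entry has `|k_{ij}|_v ≥ 1`
(`∑_j k_{ij} (k⁻¹)_{ji} = 1` with integral entries). [folklore] -/
theorem exists_one_le_valued_entry_of_mem_glFiniteIntegralLevel {k : GL (Fin n) (FiniteAdeleRing (𝓞 K) K)}
    (hk : k ∈ glFiniteIntegralLevel n K) (v : HeightOneSpectrum (𝓞 K)) (i : Fin n) :
    ∃ j : Fin n, 1 ≤ Valued.v (((k : Matrix (Fin n) (Fin n) (FiniteAdeleRing (𝓞 K) K)) i j) v) := by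
  by_contra h
  push Not at h
  rw [mem_glFiniteIntegralLevel_iff] at hk
  set f := AdelicGroupData.finiteAdeleEval K v with hf
  -- `∑_j k_{ij,v} (k⁻¹)_{ji,v} = 1`
  have hsum : ∑ j, f ((k : Matrix (Fin n) (Fin n) (FiniteAdeleRing (𝓞 K) K)) i j) *
      f (((k⁻¹ : GL (Fin n) (FiniteAdeleRing (𝓞 K) K)) : Matrix (Fin n) (Fin n) (FiniteAdeleRing (𝓞 K) K)) j i) = 1 := by
    have h1 := congrFun (congrFun (Units.mul_inv k) i) i
    rw [Matrix.mul_apply, Matrix.one_apply_eq] at h1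
    have h2 := congrArg f h1
    rw [map_sum, map_one] at h2
    simpa only [map_mul] using h2
  have hlt : Valued.v (∑ j, f ((k : Matrix (Fin n) (Fin n) (FiniteAdeleRing (𝓞 K) K)) i j) *
      f (((k⁻¹ : GL (Fin n) (FiniteAdeleRing (𝓞 K) K)) : Matrix (Fin n) (Fin n) (FiniteAdeleRing (𝓞 K) K)) j i)) < 1 := by
    refine Valuation.map_sum_lt _ one_ne_zero fun j _ => ?_
    rw [map_mul]
    have hb : Valued.v (f (((k⁻¹ : GL (Fin n) (FiniteAdeleRing (𝓞 K) K)) : Matrix (Fin n) (Fin n) (FiniteAdeleRing (𝓞 K) K)) j i)) ≤ 1 :=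
      (HeightOneSpectrum.mem_adicCompletionIntegers (𝓞 K) K v).1 (mem_integralFiniteAdeles_iff.1 (hk.2 j i) v)
    calc Valued.v (f ((k : Matrix (Fin n) (Fin n) (FiniteAdeleRing (𝓞 K) K)) i j)) *
          Valued.v (f (((k⁻¹ : GL (Fin n) (FiniteAdeleRing (𝓞 K) K)) : Matrix (Fin n) (Fin n) (FiniteAdeleRing (𝓞 K) K)) j i))
        ≤ Valued.v (f ((k : Matrix (Fin n) (Fin n) (FiniteAdeleRing (𝓞 K) K)) i j)) * 1 := mul_le_mul' le_rfl hb
      _ < 1 := by rw [mul_one]; exact h j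
  rw [hsum, map_one] at hlt
  exact lt_irrefl _ hlt

/-- Entries of `k ∈ GL_n(𝒪̂_K)` are integral: `|k_{ij}|_v ≤ 1`. [folklore] -/
theorem valued_entry_le_one_of_mem_glFiniteIntegralLevel {k : GL (Fin n) (FiniteAdeleRing (𝓞 K) K)}
    (hk : k ∈ glFiniteIntegralLevel n K) (v : HeightOneSpectrum (𝓞 K)) (i j : Fin n) :
    Valued.v (((k : Matrix (Fin n) (Fin n) (FiniteAdeleRing (𝓞 K) K)) i j) v) ≤ 1 :=
  (HeightOneSpectrum.mem_adicCompletionIntegers (𝓞 K) K v).1 (mem_integralFiniteAdeles_iff.1 ((mem_glFiniteIntegralLevel_iff.1 hk).1 i j) v)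

/-- **Finite entries of `h = (⋯, diag(t) k)`**: `|(h_{lj})_v| ≤ |t_{l,v}|`, with equality up to a
unit for some `j`. [folklore] -/
theorem valued_entry_le_of_sndHom_eq {h : GL (Fin n) (AdeleRing (𝓞 K) K)} {t : Fin n → (FiniteAdeleRing (𝓞 K) K)ˣ}
    {k : GL (Fin n) (FiniteAdeleRing (𝓞 K) K)} (hk : k ∈ glFiniteIntegralLevel n K)
    (hh : GLn.sndHom n K h = glDiagonal n (FiniteAdeleRing (𝓞 K) K) t * k) (v : HeightOneSpectrum (𝓞 K)) (l j : Fin n) :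
    Valued.v ((((h : Matrix (Fin n) (Fin n) (AdeleRing (𝓞 K) K)) l j).2) v) ≤
      Valued.v (((t l : (FiniteAdeleRing (𝓞 K) K)ˣ) : FiniteAdeleRing (𝓞 K) K) v) := by
  have e : ((h : Matrix (Fin n) (Fin n) (AdeleRing (𝓞 K) K)) l j).2 =
      ((t l : (FiniteAdeleRing (𝓞 K) K)ˣ) : FiniteAdeleRing (𝓞 K) K) * (k : Matrix (Fin n) (Fin n) (FiniteAdeleRing (𝓞 K) K)) l j := by
    rw [← GLn.coe_sndHom_apply', hh, Units.val_mul, coe_glDiagonal, Matrix.diagonal_mul]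
  rw [e, show (((t l : (FiniteAdeleRing (𝓞 K) K)ˣ) : FiniteAdeleRing (𝓞 K) K) * (k : Matrix (Fin n) (Fin n) (FiniteAdeleRing (𝓞 K) K)) l j) v =
      ((t l : (FiniteAdeleRing (𝓞 K) K)ˣ) : FiniteAdeleRing (𝓞 K) K) v * ((k : Matrix (Fin n) (Fin n) (FiniteAdeleRing (𝓞 K) K)) l j) v from rfl,
    map_mul]
  exact mul_le_of_le_one_right' (valued_entry_le_one_of_mem_glFiniteIntegralLevel hk v l j)

/-- **The torus coordinate is read off a row**: `|t_{l,v}| ≤ |(h_{lj})_v|` for some `j`. [folklore] -/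
theorem exists_valued_le_valued_entry_of_sndHom_eq {h : GL (Fin n) (AdeleRing (𝓞 K) K)} {t : Fin n → (FiniteAdeleRing (𝓞 K) K)ˣ}
    {k : GL (Fin n) (FiniteAdeleRing (𝓞 K) K)} (hk : k ∈ glFiniteIntegralLevel n K)
    (hh : GLn.sndHom n K h = glDiagonal n (FiniteAdeleRing (𝓞 K) K) t * k) (v : HeightOneSpectrum (𝓞 K)) (l : Fin n) :
    ∃ j : Fin n, Valued.v (((t l : (FiniteAdeleRing (𝓞 K) K)ˣ) : FiniteAdeleRing (𝓞 K) K) v) ≤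
      Valued.v ((((h : Matrix (Fin n) (Fin n) (AdeleRing (𝓞 K) K)) l j).2) v) := by
  obtain ⟨j, hj⟩ := exists_one_le_valued_entry_of_mem_glFiniteIntegralLevel hk v l
  refine ⟨j, ?_⟩
  have e : ((h : Matrix (Fin n) (Fin n) (AdeleRing (𝓞 K) K)) l j).2 =
      ((t l : (FiniteAdeleRing (𝓞 K) K)ˣ) : FiniteAdeleRing (𝓞 K) K) * (k : Matrix (Fin n) (Fin n) (FiniteAdeleRing (𝓞 K) K)) l j := by
    rw [← GLn.coe_sndHom_apply', hh, Units.val_mul, coe_glDiagonal, Matrix.diagonal_mul]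
  rw [e, show (((t l : (FiniteAdeleRing (𝓞 K) K)ˣ) : FiniteAdeleRing (𝓞 K) K) * (k : Matrix (Fin n) (Fin n) (FiniteAdeleRing (𝓞 K) K)) l j) v =
      ((t l : (FiniteAdeleRing (𝓞 K) K)ˣ) : FiniteAdeleRing (𝓞 K) K) v * ((k : Matrix (Fin n) (Fin n) (FiniteAdeleRing (𝓞 K) K)) l j) v from rfl,
    map_mul]
  exact le_mul_of_one_le_right' hj

/-- **Archimedean entries of `h = (diag(d) κ, ⋯)`**: `‖(h_{lj})_∞‖ ≤ ‖d_l‖` (entries of `κ ∈ K_∞`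
have norm `≤ 1`). [folklore] -/
theorem norm_entry_le_of_toMixed_eq {h : GL (Fin n) (AdeleRing (𝓞 K) K)} {dd : Fin n → (mixedSpace K)ˣ}
    {κ : GL (Fin n) (mixedSpace K)} (hκ : κ ∈ Kinf n K)
    (hh : GLn.toMixed n K h = glDiagonal n (mixedSpace K) dd * κ) (l j : Fin n) :
    ‖InfiniteAdeleRing.ringEquiv_mixedSpace K (((h : Matrix (Fin n) (Fin n) (AdeleRing (𝓞 K) K)) l j).1)‖ ≤
      ‖((dd l : (mixedSpace K)ˣ) : mixedSpace K)‖ := by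
  rw [← GLn.coe_toMixed_apply', hh, Units.val_mul, coe_glDiagonal, Matrix.diagonal_mul]
  refine (norm_mul_le _ _).trans ?_
  exact mul_le_of_le_one_right (norm_nonneg _) (norm_entry_le_one_of_mem_Kinf hκ l j)

/-- **The archimedean torus coordinate is read off a row**: if `d_{l,w} = ρ > 0` then
`ρ ≤ n · ‖(h_{lj})_∞‖` for some `j` (a row of `κ_w` has an entry of size `≥ 1/n`). [folklore] -/
theorem exists_le_mul_norm_entry_of_toMixed_eq [NeZero n] {h : GL (Fin n) (AdeleRing (𝓞 K) K)} {dd : Fin n → (mixedSpace K)ˣ}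
    {κ : GL (Fin n) (mixedSpace K)} (hκ : κ ∈ Kinf n K)
    (hh : GLn.toMixed n K h = glDiagonal n (mixedSpace K) dd * κ) (w : InfinitePlace K) (l : Fin n) {ρ : ℝ} (hρ : 0 ≤ ρ)
    (hd : mixedSpaceEvalAt K w ((dd l : (mixedSpace K)ˣ) : mixedSpace K) = (ρ : ℂ)) :
    ∃ j : Fin n, ρ ≤ n * ‖InfiniteAdeleRing.ringEquiv_mixedSpace K (((h : Matrix (Fin n) (Fin n) (AdeleRing (𝓞 K) K)) l j).1)‖ := by
  obtain ⟨j, hj⟩ := exists_inv_le_norm_entry_of_mem_Kinf hκ w l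
  refine ⟨j, ?_⟩
  have hn : (0 : ℝ) < n := by exact_mod_cast Nat.pos_of_ne_zero (NeZero.ne n)
  rw [← GLn.coe_toMixed_apply', hh, Units.val_mul, coe_glDiagonal, Matrix.diagonal_mul]
  have h1 : ρ * (n : ℝ)⁻¹ ≤ ‖mixedSpaceEvalAt K w (((dd l : (mixedSpace K)ˣ) : mixedSpace K) *
      (κ : Matrix (Fin n) (Fin n) (mixedSpace K)) l j)‖ := by
    rw [map_mul, norm_mul, hd, Complex.norm_real, Real.norm_of_nonneg hρ]
    exact mul_le_mul_of_nonneg_left hj hρ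
  calc ρ = n * (ρ * (n : ℝ)⁻¹) := by field_simp
    _ ≤ n * ‖mixedSpaceEvalAt K w (((dd l : (mixedSpace K)ˣ) : mixedSpace K) * (κ : Matrix (Fin n) (Fin n) (mixedSpace K)) l j)‖ :=
        mul_le_mul_of_nonneg_left h1 hn.le
    _ ≤ n * ‖((dd l : (mixedSpace K)ˣ) : mixedSpace K) * (κ : Matrix (Fin n) (Fin n) (mixedSpace K)) l j‖ :=
        mul_le_mul_of_nonneg_left (norm_mixedSpaceEvalAt_le w _) hn.le

/-- **Archimedean size of the entries of `Ω h`** for `Ω` in Tate's box: if all entries of `Ω` lie in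
`D ∪ {0, 1}` (box bound `B`) and `‖(h_{lj})_∞‖ ≤ R` for all `l, j`, then `‖((Ω h)_{ij})_∞‖ ≤ n B R`.
[folklore] -/
theorem norm_entry_mul_le {Ω h : GL (Fin n) (AdeleRing (𝓞 K) K)} {B R : ℝ}
    (hΩ : ∀ i l, ‖InfiniteAdeleRing.ringEquiv_mixedSpace K (((Ω : Matrix (Fin n) (Fin n) (AdeleRing (𝓞 K) K)) i l).1)‖ ≤ B)
    (hh : ∀ l j, ‖InfiniteAdeleRing.ringEquiv_mixedSpace K (((h : Matrix (Fin n) (Fin n) (AdeleRing (𝓞 K) K)) l j).1)‖ ≤ R)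
    (i j : Fin n) :
    ‖InfiniteAdeleRing.ringEquiv_mixedSpace K ((((Ω * h : GL (Fin n) (AdeleRing (𝓞 K) K)) :
        Matrix (Fin n) (Fin n) (AdeleRing (𝓞 K) K)) i j).1)‖ ≤ n * B * R := by
  set f : AdeleRing (𝓞 K) K →+* mixedSpace K :=
    (InfiniteAdeleRing.ringEquiv_mixedSpace K).toRingHom.comp (RingHom.fst (InfiniteAdeleRing K) (FiniteAdeleRing (𝓞 K) K)) with hf
  have hfa : ∀ a : AdeleRing (𝓞 K) K, InfiniteAdeleRing.ringEquiv_mixedSpace K a.1 = f a := fun a => rfl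
  have hB : 0 ≤ B := (norm_nonneg _).trans (hΩ i i)
  rw [hfa, Units.val_mul, Matrix.mul_apply, map_sum]
  calc ‖∑ l, f ((Ω : Matrix (Fin n) (Fin n) (AdeleRing (𝓞 K) K)) i l * (h : Matrix (Fin n) (Fin n) (AdeleRing (𝓞 K) K)) l j)‖
      ≤ ∑ l, ‖f ((Ω : Matrix (Fin n) (Fin n) (AdeleRing (𝓞 K) K)) i l * (h : Matrix (Fin n) (Fin n) (AdeleRing (𝓞 K) K)) l j)‖ :=
        norm_sum_le _ _
    _ ≤ ∑ _l : Fin n, B * R := Finset.sum_le_sum fun l _ => by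
        rw [map_mul]
        refine (norm_mul_le _ _).trans ?_
        rw [← hfa, ← hfa]
        exact mul_le_mul (hΩ i l) (hh l j) (norm_nonneg _) hB
    _ = n * B * R := by rw [Finset.sum_const, Finset.card_univ, Fintype.card_fin, nsmul_eq_mul, mul_assoc]

/-- **Finite integrality of the entries of `Ω h`** for `Ω` in Tate's box: if the finite components of
the entries of `Ω` are integral and `|(h_{lj})_v| · β ≤ 1` for all `l, j`, then
`|((Ω h)_{ij})_v| · β ≤ 1`. [folklore] -/
theorem valued_entry_mul_mul_le_one {Ω h : GL (Fin n) (AdeleRing (𝓞 K) K)} (v : HeightOneSpectrum (𝓞 K))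
    {β : WithZero (Multiplicative ℤ)}
    (hΩ : ∀ i l, Valued.v ((((Ω : Matrix (Fin n) (Fin n) (AdeleRing (𝓞 K) K)) i l).2) v) ≤ 1)
    (hh : ∀ l j, Valued.v ((((h : Matrix (Fin n) (Fin n) (AdeleRing (𝓞 K) K)) l j).2) v) * β ≤ 1) (i j : Fin n) :
    Valued.v (((((Ω * h : GL (Fin n) (AdeleRing (𝓞 K) K)) : Matrix (Fin n) (Fin n) (AdeleRing (𝓞 K) K)) i j).2) v) * β ≤ 1 := by
  by_cases hβ : β = 0
  · rw [hβ, mul_zero]; exact zero_le_one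
  set f : AdeleRing (𝓞 K) K →+* v.adicCompletion K :=
    (AdelicGroupData.finiteAdeleEval K v).comp (RingHom.snd (InfiniteAdeleRing K) (FiniteAdeleRing (𝓞 K) K)) with hf
  have hfa : ∀ a : AdeleRing (𝓞 K) K, a.2 v = f a := fun a => rfl
  rw [hfa, Units.val_mul, Matrix.mul_apply, map_sum, ← le_div_iff₀ (zero_lt_iff.2 hβ), one_div]
  refine Valuation.map_sum_le _ fun l _ => ?_
  rw [map_mul, map_mul, ← hfa, ← hfa]
  have h1 := hh l j
  rw [← le_div_iff₀ (zero_lt_iff.2 hβ), one_div] at h1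
  exact (mul_le_mul' (hΩ i l) h1).trans_eq (one_mul _)

end Rows

end Literature.NumberTheory.Automorphic
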